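import Mathlib
import Summits.Ventures.PercRepro2.SwOutCrossBaseMono

/-!
# The cross base: THE TYPE LEMMA (blind cell PercRepro2, night-4 g23, 2026-08-28;
proofs/NIGHT4-G23.md §10, step (3))

For two points `x ≤ x'` of the cube in the order of `card_le_crossGenFar` (the restricted partition
order of the edge-atom fibre data `fibKEE`) that do not leak, the pulled-back conditioning
`tgtU l h {S | o ∈ S}` (`h` outside the hull of `l`, `o` red-connected to `l`, `o` not
blue-connected to `l`) is monotone: if the realisation of `x` lies in it, so does the realisation
of `x'`. The red connection is `CrossBase.conn_mono`; the blue connection is its dual (the dual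
base at the flipped points, where the order reverses: `betterFG_flip`); `h ∉ hull l` holds at every
non-leaking point since the hull of `h` lies inside the structure (`hull_crossReal_subset`).
-/

namespace Summit.Ventures.PercRepro2

namespace CrossArm

open Hull LocRows

variable {V E : Type*}

open scoped Classical

section Order

variable {ι X κ : Type*} {G : SimpleGraph X}

/-- The far-arm bits of the flipped point. -/
lemma flipXG_far (q : PtXG ι κ X G) (k : κ) : (flipXG G q).1 k = !q.1 k := rfl

/-- The u-arm bits of the flipped point. -/
lemma flipXG_arm (q : PtXG ι κ X G) (j : ι) : (flipXG G q).2.1 j = !q.2.1 j := rfl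

/-- The outside bits of the flipped point. -/
lemma flipXG_ext (q : PtXG ι κ X G) (i : X) : (flipXG G q).2.2.2.2 i = !q.2.2.2.2 i := rfl

/-- The fibre point of the flipped point. -/
lemma flipXG_fib (q : PtXG ι κ X G) : (flipXG G q).2.2 = q.2.2.flip := rfl

variable [Fintype X] [DecidableEq X] [DecidableRel G.Adj] [Nonempty X] (hG : G.Connected)

/-- The order of `card_le_crossGenFar` on the edge-atom fibre data, unpacked: blue far arms stay
blue, blue u-arms stay blue, red ports stay red ports, red links between red ports are kept, blue
links between blue ports of the better point were already present. -/
lemma betterFG_iff {x x' : PtXG ι κ X G} :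
    BetterFG (fibKEE G hG) (typFG (fibKEE G hG) (toGen G x'))
        (typFG (fibKEE G hG) (toGen G x)) ↔
      (∀ k, x.1 k = false → x'.1 k = false) ∧ (∀ j, x.2.1 j = false → x'.2.1 j = false) ∧
        (∀ i, x.2.2.2.2 i = false → x'.2.2.2.2 i = false) ∧
        (∀ i j, x.2.2.2.2 i = false ∧ x.2.2.2.2 j = false ∧ rlinkE G x.2.2 i j →
          x'.2.2.2.2 i = false ∧ x'.2.2.2.2 j = false ∧ rlinkE G x'.2.2 i j) ∧
        (∀ i j, x'.2.2.2.2 i = true ∧ x'.2.2.2.2 j = true ∧ rlinkE G x'.2.2.flip i j →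
          x.2.2.2.2 i = true ∧ x.2.2.2.2 j = true ∧ rlinkE G x.2.2.flip i j) :=
  Iff.rfl

/-- **The order reverses under the flip**: `x ≤ x'` gives `flip x' ≤ flip x`. -/
lemma betterFG_flip {x x' : PtXG ι κ X G}
    (hord : BetterFG (fibKEE G hG) (typFG (fibKEE G hG) (toGen G x'))
      (typFG (fibKEE G hG) (toGen G x))) :
    BetterFG (fibKEE G hG) (typFG (fibKEE G hG) (toGen G (flipXG G x)))
      (typFG (fibKEE G hG) (toGen G (flipXG G x'))) := by
  rw [betterFG_iff] at hord ⊢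
  obtain ⟨hfar, harm, hext, hlink, hblink⟩ := hord
  refine ⟨?_, ?_, ?_, ?_, ?_⟩
  · intro k hk
    rw [flipXG_far, Bool.not_eq_false'] at hk ⊢
    cases hxk : x.1 k
    · exact absurd (hfar k hxk) (by rw [hk]; decide)
    · rfl
  · intro j hj
    rw [flipXG_arm, Bool.not_eq_false'] at hj ⊢
    cases hxj : x.2.1 j
    · exact absurd (harm j hxj) (by rw [hj]; decide)
    · rfl
  · intro i hi
    rw [flipXG_ext, Bool.not_eq_false'] at hi ⊢
    cases hxi : x.2.2.2.2 i
    · exact absurd (hext i hxi) (by rw [hi]; decide)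
    · rfl
  · intro i j hij
    rw [flipXG_ext, flipXG_ext, flipXG_fib, Bool.not_eq_false', Bool.not_eq_false'] at hij
    rw [flipXG_ext, flipXG_ext, flipXG_fib, Bool.not_eq_false', Bool.not_eq_false']
    exact hblink i j hij
  · intro i j hij
    rw [flipXG_ext, flipXG_ext, flipXG_fib, FibKE.flip_flip, Bool.not_eq_true',
      Bool.not_eq_true'] at hij
    rw [flipXG_ext, flipXG_ext, flipXG_fib, FibKE.flip_flip, Bool.not_eq_true',
      Bool.not_eq_true']
    exact hlink i j hij

end Order

section TypeLemma

variable {ends : E → Sym2 V} {σ : Config E} {h u : V} {ι X κ : Type*} {U : ι → Set V}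
  {p : X → V} {G : SimpleGraph X} {F : κ → Set V} [Fintype X] [DecidableEq X]
  [DecidableRel G.Adj] [Nonempty X] (hG : G.Connected) (hb : CrossBase ends σ h u U p G F)
include hb

/-- **Blue connection outside the structure is antitone in the type** (the dual of
`conn_mono`): for `x ≤ x'`, `x'` without blue-side leak, `l`, `o` outside the structure with `h`
not blue-reached from `l` at `x'`, a blue connection `l – o` at `x'` is a blue connection at `x`. -/
theorem CrossBase.conn_blue_anti (hup : ∀ i, ∃ e, ends e = s(u, p i))
    (hcross : ∀ i j, G.Adj i j → ∃ e, ends e = s(p i, p j)) {x x' : PtXG ι κ X G}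
    (hx'B : ¬ LeakBX G x')
    (hord : BetterFG (fibKEE G hG) (typFG (fibKEE G hG) (toGen G x'))
      (typFG (fibKEE G hG) (toGen G x)))
    {l o : V} (hl : l ∉ strX h u U p F) (ho : o ∉ strX h u U p F)
    (hlh : ¬ Conn ends (blue (crossReal ends u U p G F σ x')) l h)
    (hlo : Conn ends (blue (crossReal ends u U p G F σ x')) l o) :
    Conn ends (blue (crossReal ends u U p G F σ x)) l o := by
  rw [hb.blue_crossReal] at hlh hlo ⊢
  obtain ⟨hfar, harm, hext, hlink, -⟩ := (betterFG_iff hG).1 (betterFG_flip hG hord)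
  exact hb.dual.conn_mono hup hcross hx'B harm hfar hext
    (fun i m hi hm hr => (hlink i m ⟨hi, hm, hr⟩).2.2) hl ho hlh hlo

/-- **THE TYPE LEMMA.** For non-leaking points `x ≤ x'` in the order of `card_le_crossGenFar` and
`l`, `o` outside the structure: if the realisation of `x` lies in the pulled-back conditioning
`tgtU l h {S | o ∈ S}`, so does the realisation of `x'`. -/
theorem CrossBase.mem_tgtU_of_betterFG [Fintype E] [DecidableEq E]
    (hup : ∀ i, ∃ e, ends e = s(u, p i))
    (hcross : ∀ i j, G.Adj i j → ∃ e, ends e = s(p i, p j)) {x x' : PtXG ι κ X G}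
    (hxR : ¬ LeakRX G x) (hx'R : ¬ LeakRX G x') (hx'B : ¬ LeakBX G x')
    (hord : BetterFG (fibKEE G hG) (typFG (fibKEE G hG) (toGen G x'))
      (typFG (fibKEE G hG) (toGen G x)))
    {l o : V} (hl : l ∉ strX h u U p F) (ho : o ∉ strX h u U p F)
    (hx : crossReal ends u U p G F σ x ∈ tgtU ends l h {S | o ∈ S}) :
    crossReal ends u U p G F σ x' ∈ tgtU ends l h {S | o ∈ S} := by
  simp only [tgtU, Finset.mem_filter, Finset.mem_univ, true_and, Set.mem_setOf_eq,
    mem_cluster] at hx ⊢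
  obtain ⟨hxh, hxo, hxb⟩ := hx
  obtain ⟨hfar, harm, hext, hlink, -⟩ := (betterFG_iff hG).1 hord
  have hlh : ¬ Conn ends (crossReal ends u U p G F σ x) l h := fun hc => hxh (Or.inl hc)
  have h1 : h ∉ hull ends (crossReal ends u U p G F σ x') l := by
    intro hh
    have hlh' : l ∈ hull ends (crossReal ends u U p G F σ x') h := by
      rcases hh with hh | hh
      · exact Or.inl (conn_symm hh)
      · exact Or.inr (conn_symm hh)
    exact hl (hb.hull_crossReal_subset hup hcross hx'R hx'B hlh')
  refine ⟨h1, ?_, ?_⟩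
  · exact hb.conn_mono hup hcross hxR harm hfar hext
      (fun i m hi hm hr => (hlink i m ⟨hi, hm, hr⟩).2.2) hl ho hlh hxo
  · intro hc
    exact hxb (hb.conn_blue_anti hG hup hcross hx'B hord hl ho (fun hc' => h1 (Or.inr hc')) hc)

end TypeLemma

end CrossArm

end Summit.Ventures.PercRepro2
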